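import Summits.QuantumFields.BalabanUV.Beta.GAN24.OneStepConstraintAxialLetters
import Summits.QuantumFields.BalabanUV.Beta.GAN24.OneStepConstraintLocalisation

/-!
# `BalabanUV.Beta.GAN24.OneStepConstraintAxialGauges` — binder row G-an2-4 ∕ (CONV-C), routes C-R6° («VALUES») × R7 («TWO CURRENCIES»), PART 180 (file 1 of 2):
# PART 105 ∕ 106's LETTERS FOR THE STACKED ONE-STEP CONSTRAINT `Q_ax = fromRows (re QB N R M) E` ON THE STACKED INDEX `(coarse bonds) ⊕ T`, KEYED BY THE BLOCK PARENT —
# pseudo-distance, lattice-sum profile `d(1+R^d)·Kf`, row mass `q₁ = 1`, block compatibilities `R = 2`, `R′ = 1`, and the entries of the stacked regularised form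
# `K = H + Q_axᵀ(a•1)Q_ax` (`|K(x,x′)| ≤ c_K·e^{−δ_H·tdist(par x, par x′)}`) — for ANY embedded bond family `ι : T ↪ (fine bonds)` (the axial tree is one) — census V200″ (α′)
# (unit b2b-balaban-gan24-p3, gen 60; v1)

NOT IN PRINT; OUR PROOF ([folklore] bookkeeping BY NAME over PART 105 `EffectiveFormLocalisation.transpose_mul_smul_one_mul`, PART 168 `OneStepConstraintLetters` (`sum_abs_reM_QB_row`,
`sum_eq_sum_par_off`), PART 169 `OneStepConstraintLettersReg.tdist_par_le_one_of_reM_QB_ne_zero`, PART 170 `OneStepConstraintLocalisation.abs_regForm_apply_le`, PART 177 `StackedConstraintLetters`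
(`ext_apply_embed`, `ext_apply_of_not_range`, `sum_abs_proj_row`), Mathlib's `Matrix.fromRows` calculus (`transpose_fromRows`, `fromCols_mul_fromRows`) and `VectorTailsCov.tdist`.
[Balaban1984PropagatorsII] (2.121) p. 244, (2.152)–(2.157) pp. 249–250 LOCATE why the one-loop step's constraint is the PAIR (averaging, axial gauge); nothing printed is a hypothesis.)
HONEST FRAMING (cell contract, verbatim): «discharging `BetaPertH` makes Bałaban's UV stability UNCONDITIONAL — a real constructive-QFT result; it is NOT the continuum limit
and NOT the Clay problem.»  HONEST DEPENDENCY (verbatim): «continuum YM on T⁴ ⇐ BetaPertH ∧ nine spine estimates (0/9 proved); BetaPertH ⇐ (D1) ∧ (D4) ∧ CAP+tail; G-an2-4 gates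
asym, D1 and NE2/3/4.»

WHY (census V200″, gen 59).  PARTs 175–179: the lineage's effective form `Σ_k` is exactly gauge invariant, so the one-loop step's constraint must be the STACKED matrix
`Q_ax = fromRows (re QB) E` (Bałaban's averaging AND the coordinate projection `E` onto the axial tree bonds); PARTs 177 ∕ 178 typed its right-inverse ∕ coercivity letters and PART 179
discharged the regularised coercivity for `H = re Δ_k` from pv09's (2.153).  What PART 170-type ENDs still need are PART 105 ∕ 106's OTHER letters on the stacked coarse index
`(Tor (fine N M) × Fin d) ⊕ T` — THIS FILE supplies them, for ANY embedded bond family `ι : T ↪ (fine bonds)`, keyed by the block parent: the coarse KEY of a stacked index is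
`key (inl (y,μ)) = y`, `key (inr t) = par (ι t)`, and all three gauges are torus distances of keys ∕ parents.  The companion file `OneStepConstraintAxialLocalisation` (PART 180, 2∕2)
turns them into the soft letter and the three ENDs.

THE GAUGES (no `def`; `VectorTailsCov.tdist` cast to `ℝ`; `key = Sum.elim (·.1) (par ∘ ι)` spelled inline): coarse `ρ(b,b′) = tdist(key b, key b′)`; fine `D(x,x′) = tdist(par x.1, par x′.1)`;
fine-to-coarse `σ(x,b) = tdist(par x.1, key b)`.
WHAT THIS FILE PROVES (0 sorry, 0 `def`; `N, R ≥ 1`, every torus `M`, every `d`, every finite `T` with `ι : T ↪ Tor (fine (R·N) M) × Fin d`):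
* §1 `isPseudoDist_key`; `sum_exp_coarse_le`, `sum_exp_fine_par_le`, `sum_embed_le`, **`sum_exp_key_le`** (`Σ_{b′} e^{−s·tdist(y, key b′)} ≤ d(1+R^d)·Kf(s)`), **`sumBound_key`**, `sum_exp_sigma_key_le`;
  **`sum_abs_fromRows_row`** (row mass `q₁ = 1` for BOTH row families); **`tdist_key_par_le_one`** (support: `Q_ax(b,x) ≠ 0 ⟹ tdist(key b, par x) ≤ 1`),
  **`tdist_key_le_tdist_par_add_two`** (`hQρ`, `R = 2`), **`tdist_par_key_le_tdist_par_add_one`** (`hQσ`, `R′ = 1`).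
* §2 **`fromRows_reg_eq`** (`Q_axᵀ(a•1)Q_ax = Qᵀ(a•1)Q + Eᵀ(a•1)E`, generic), **`abs_projSum_le`** (`|(Eᵀ(a•1)E)(x,x′)| = |a·Σ_t [x = ι t][x′ = ι t]| ≤ a·e^{−δ_H D}`: diagonal, entries `≤ a`),
  **`stackedReg_apply`**, **`abs_regFormAx_apply_le`** (`|K(x,x′)| ≤ ((h₀ + a·R^{−d}R^{−d}·e^{2δ_H}) + a)·e^{−δ_H·D}` from `|H(x,x′)| ≤ h₀e^{−δ_H·D}`).
WHAT IT IS NOT: no decay of an inverse here (file 2); no model-side input is discharged.  SUPPLIER work; NEVER «G-an2-4 closed»; NOT (CONV-C), NOT D1, NOT `BetaPertH`, NOT continuum, NOT Clay.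
Records: `HOME/b2b-balaban-gan24-p3/gen60/README.md`.
-/

noncomputable section

open scoped BigOperators Matrix
open Finset Matrix

namespace Summit.QuantumFields.BalabanUV.Beta.GAN24.OneStepConstraintAxialGauges

open Literature.MathematicalPhysics.QuantumFieldTheory.Balaban1983to89
open Literature.MathematicalPhysics.QuantumFieldTheory.Balaban1983to89.B4Sect5Torus (IsPseudoDist SumBound)
open Literature.MathematicalPhysics.QuantumFieldTheory.Balaban1983to89.B5Prop11Plancherel (Tor fine)
open Literature.MathematicalPhysics.QuantumFieldTheory.Balaban1983to89.B5RealFields (reM)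
open Literature.MathematicalPhysics.QuantumFieldTheory.Balaban1983to89.Beta.VectorTailsCov (tdist tdist_self tdist_triangle tdist_comm)
open Summit.QuantumFields.BalabanUV.T4Continuum.BalabanLineAverage (QB)
open Summit.QuantumFields.BalabanUV.T4Continuum.BalabanAveragedTowerModes (par par_cpt_add_off)
open Summit.QuantumFields.BalabanUV.Beta.GAN24.EffectiveFormLocalisation (transpose_mul_smul_one_mul)
open Summit.QuantumFields.BalabanUV.Beta.GAN24.OneStepConstraintLetters (sum_abs_reM_QB_row sum_eq_sum_par_off)
open Summit.QuantumFields.BalabanUV.Beta.GAN24.OneStepConstraintLettersReg (tdist_par_le_one_of_reM_QB_ne_zero)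
open Summit.QuantumFields.BalabanUV.Beta.GAN24.OneStepConstraintLocalisation (abs_regForm_apply_le)
open Summit.QuantumFields.BalabanUV.Beta.GAN24.StackedConstraintLetters (ext_apply_embed ext_apply_of_not_range sum_abs_proj_row)

variable {d : ℕ} (N R : ℕ) [NeZero N] [NeZero R] (M : Fin d → ℕ) [hM : ∀ μ, NeZero (M μ)]
variable {T : Type*} [Fintype T] [DecidableEq T] (ι : T ↪ Tor (fine (R * N) M) × Fin d)

/-! ## §1 PART 105 ∕ 106's letters on the stacked index `(coarse bonds) ⊕ T`, keyed by the block parent -/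

section Gauges

omit [NeZero R] [Fintype T] [DecidableEq T] in
/-- the coarse gauge of the stacked index, `ρ(b,b′) = tdist(key b, key b′)` with `key (inl (y,μ)) = y`, `key (inr t) = par (ι t)`, is a pseudo-distance. [folklore] -/
theorem isPseudoDist_key :
    IsPseudoDist (fun b b' : (Tor (fine N M) × Fin d) ⊕ T =>
      (tdist (Sum.elim (fun b : Tor (fine N M) × Fin d => b.1) (fun t : T => par N R M (ι t).1) b)
             (Sum.elim (fun b : Tor (fine N M) × Fin d => b.1) (fun t : T => par N R M (ι t).1) b') : ℝ)) :=
  ⟨fun _ _ => by rw [tdist_comm], fun _ => by rw [tdist_self, Nat.cast_zero], fun _ _ _ => by exact_mod_cast tdist_triangle _ _ _⟩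

variable {Kf : ℝ → ℝ}

omit [NeZero R] in
/-- coarse bond sums about an arbitrary coarse site: `Σ_{(y′,μ′)} e^{−s·tdist(y,y′)} ≤ d·Kf(s)`. [folklore] -/
theorem sum_exp_coarse_le (hKf : ∀ s : ℝ, 0 < s → ∀ y : Tor (fine N M), ∑ y' : Tor (fine N M), Real.exp (-(s * (tdist y y' : ℝ))) ≤ Kf s)
    {s : ℝ} (hs : 0 < s) (y : Tor (fine N M)) :
    ∑ b : Tor (fine N M) × Fin d, Real.exp (-(s * (tdist y b.1 : ℝ))) ≤ (d : ℝ) * Kf s := by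
  rw [Fintype.sum_prod_type]
  simp only [Finset.sum_const, Finset.card_univ, Fintype.card_fin, nsmul_eq_mul]
  rw [← Finset.mul_sum]
  exact mul_le_mul_of_nonneg_left (hKf s hs y) (Nat.cast_nonneg d)

/-- fine bond sums against the block parent, about an arbitrary coarse site: `Σ_{x′} e^{−s·tdist(y, par x′)} ≤ d·R^d·Kf(s)` (each block carries `R^d` sites per component). [folklore] -/
theorem sum_exp_fine_par_le (hKf : ∀ s : ℝ, 0 < s → ∀ y : Tor (fine N M), ∑ y' : Tor (fine N M), Real.exp (-(s * (tdist y y' : ℝ))) ≤ Kf s)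
    {s : ℝ} (hs : 0 < s) (y : Tor (fine N M)) :
    ∑ x : Tor (fine (R * N) M) × Fin d, Real.exp (-(s * (tdist y (par N R M x.1) : ℝ))) ≤ (d : ℝ) * (R : ℝ) ^ d * Kf s := by
  rw [Fintype.sum_prod_type]
  simp only [Finset.sum_const, Finset.card_univ, Fintype.card_fin, nsmul_eq_mul]
  rw [sum_eq_sum_par_off N R M (fun w : Tor (fine (R * N) M) => (d : ℝ) * Real.exp (-(s * (tdist y (par N R M w) : ℝ))))]
  simp only [par_cpt_add_off, Finset.sum_const, Finset.card_univ, Fintype.card_fun, Fintype.card_fin, nsmul_eq_mul, Nat.cast_pow]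
  rw [← Finset.mul_sum, ← Finset.mul_sum]
  have hRd : (0 : ℝ) ≤ (R : ℝ) ^ d := pow_nonneg (Nat.cast_nonneg R) d
  calc (R : ℝ) ^ d * ((d : ℝ) * ∑ y' : Tor (fine N M), Real.exp (-(s * (tdist y y' : ℝ))))
      ≤ (R : ℝ) ^ d * ((d : ℝ) * Kf s) := mul_le_mul_of_nonneg_left (mul_le_mul_of_nonneg_left (hKf s hs _) (Nat.cast_nonneg d)) hRd
    _ = (d : ℝ) * (R : ℝ) ^ d * Kf s := by ring

omit [DecidableEq T] in
/-- a nonnegative function summed over an embedded family is at most its sum over the whole index set. [folklore] -/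
theorem sum_embed_le {ν : Type*} [Fintype ν] (ι' : T ↪ ν) (f : ν → ℝ) (hf : ∀ x, 0 ≤ f x) : ∑ t : T, f (ι' t) ≤ ∑ x, f x := by
  rw [← Finset.sum_map Finset.univ ι' f]
  exact Finset.sum_le_sum_of_subset_of_nonneg (Finset.subset_univ _) fun x _ _ => hf x

omit [DecidableEq T] in
/-- **`sum_exp_key_le` — THE LATTICE SUMS OF THE STACKED INDEX**: `Σ_{b′ ∈ (coarse bonds) ⊕ T} e^{−s·tdist(y, key b′)} ≤ d(1 + R^d)·Kf(s)` for every coarse site `y` (the `T`-part is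
dominated by the sum over ALL fine bonds against their parents). [folklore] -/
theorem sum_exp_key_le (hKf : ∀ s : ℝ, 0 < s → ∀ y : Tor (fine N M), ∑ y' : Tor (fine N M), Real.exp (-(s * (tdist y y' : ℝ))) ≤ Kf s)
    {s : ℝ} (hs : 0 < s) (y : Tor (fine N M)) :
    ∑ b' : (Tor (fine N M) × Fin d) ⊕ T,
        Real.exp (-(s * (tdist y (Sum.elim (fun b : Tor (fine N M) × Fin d => b.1) (fun t : T => par N R M (ι t).1) b') : ℝ)))
      ≤ (d : ℝ) * (1 + (R : ℝ) ^ d) * Kf s := by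
  rw [Fintype.sum_sum_type]
  simp only [Sum.elim_inl, Sum.elim_inr]
  have h1 := sum_exp_coarse_le (d := d) N M hKf hs y
  have h2 : ∑ t : T, Real.exp (-(s * (tdist y (par N R M (ι t).1) : ℝ))) ≤ (d : ℝ) * (R : ℝ) ^ d * Kf s :=
    (sum_embed_le ι (fun x : Tor (fine (R * N) M) × Fin d => Real.exp (-(s * (tdist y (par N R M x.1) : ℝ))))
      fun x => (Real.exp_pos _).le).trans (sum_exp_fine_par_le N R M hKf hs y)
  calc _ ≤ (d : ℝ) * Kf s + (d : ℝ) * (R : ℝ) ^ d * Kf s := add_le_add h1 h2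
    _ = (d : ℝ) * (1 + (R : ℝ) ^ d) * Kf s := by ring

omit [DecidableEq T] in
/-- **`sumBound_key`** — PART 105's `SumBound ρ (d(1+R^d)·Kf)` for the coarse gauge of the stacked index. [folklore] -/
theorem sumBound_key (hKf : ∀ s : ℝ, 0 < s → ∀ y : Tor (fine N M), ∑ y' : Tor (fine N M), Real.exp (-(s * (tdist y y' : ℝ))) ≤ Kf s) :
    SumBound (fun b b' : (Tor (fine N M) × Fin d) ⊕ T =>
      (tdist (Sum.elim (fun b : Tor (fine N M) × Fin d => b.1) (fun t : T => par N R M (ι t).1) b)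
             (Sum.elim (fun b : Tor (fine N M) × Fin d => b.1) (fun t : T => par N R M (ι t).1) b') : ℝ))
      (fun s => (d : ℝ) * (1 + (R : ℝ) ^ d) * Kf s) :=
  fun _ hs _ => sum_exp_key_le N R M ι hKf hs _

omit [DecidableEq T] in
/-- **the fine-to-coarse gauge sums** (PART 106's `Kσ = d(1+R^d)·Kf`): `Σ_b e^{−s·tdist(par x.1, key b)} ≤ d(1+R^d)·Kf(s)`. [folklore] -/
theorem sum_exp_sigma_key_le (hKf : ∀ s : ℝ, 0 < s → ∀ y : Tor (fine N M), ∑ y' : Tor (fine N M), Real.exp (-(s * (tdist y y' : ℝ))) ≤ Kf s)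
    {s : ℝ} (hs : 0 < s) (x : Tor (fine (R * N) M) × Fin d) :
    ∑ b : (Tor (fine N M) × Fin d) ⊕ T,
        Real.exp (-(s * (tdist (par N R M x.1) (Sum.elim (fun b : Tor (fine N M) × Fin d => b.1) (fun t : T => par N R M (ι t).1) b) : ℝ)))
      ≤ (d : ℝ) * (1 + (R : ℝ) ^ d) * Kf s :=
  sum_exp_key_le N R M ι hKf hs (par N R M x.1)

omit [Fintype T] [DecidableEq T] in
/-- **`sum_abs_fromRows_row` — ROW MASS `q₁ = 1` FOR THE STACKED CONSTRAINT**: the averaging rows are probability vectors (PART 168), the projection rows are unit coordinate vectors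
(PART 177). [folklore] -/
theorem sum_abs_fromRows_row (b : (Tor (fine N M) × Fin d) ⊕ T) :
    ∑ x, |Matrix.fromRows (reM (QB N R M)) (fun (t : T) (x : Tor (fine (R * N) M) × Fin d) => if x = ι t then (1 : ℝ) else 0) b x| ≤ 1 := by
  cases b with
  | inl b =>
    simp only [Matrix.fromRows_apply_inl]
    exact (sum_abs_reM_QB_row N R M b).le
  | inr t =>
    have h := sum_abs_proj_row ι t
    simp only [Matrix.fromRows_apply_inr] at h ⊢
    exact h.le

omit [Fintype T] [DecidableEq T] in
/-- **`tdist_key_par_le_one` — BLOCK SUPPORT OF THE STACKED CONSTRAINT**: `Q_ax(b,x) ≠ 0 ⟹ tdist(key b, par x) ≤ 1` (an averaging row sees the block of its site and the next one,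
PART 168; a projection row sees its own bond, whose key IS its parent). [folklore] -/
theorem tdist_key_par_le_one {b : (Tor (fine N M) × Fin d) ⊕ T} {x : Tor (fine (R * N) M) × Fin d}
    (h : Matrix.fromRows (reM (QB N R M)) (fun (t : T) (x : Tor (fine (R * N) M) × Fin d) => if x = ι t then (1 : ℝ) else 0) b x ≠ 0) :
    tdist (Sum.elim (fun b : Tor (fine N M) × Fin d => b.1) (fun t : T => par N R M (ι t).1) b) (par N R M x.1) ≤ 1 := by
  cases b with
  | inl b =>
    simp only [Matrix.fromRows_apply_inl] at h
    simp only [Sum.elim_inl]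
    exact tdist_par_le_one_of_reM_QB_ne_zero N R M h
  | inr t =>
    simp only [Matrix.fromRows_apply_inr] at h
    have hx : x = ι t := by
      by_contra hne
      exact h (if_neg hne)
    simp only [Sum.elim_inr]
    rw [hx, tdist_self]
    exact zero_le_one

omit [Fintype T] [DecidableEq T] in
/-- **PART 105 §4's BLOCK COMPATIBILITY `hQρ` FOR THE STACKED CONSTRAINT** (`R = 2`): `Q_ax(b,x) ≠ 0 → Q_ax(b′,x′) ≠ 0 → tdist(key b, key b′) ≤ tdist(par x, par x′) + 2`. [folklore] -/
theorem tdist_key_le_tdist_par_add_two {b b' : (Tor (fine N M) × Fin d) ⊕ T} {x x' : Tor (fine (R * N) M) × Fin d}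
    (hb : Matrix.fromRows (reM (QB N R M)) (fun (t : T) (x : Tor (fine (R * N) M) × Fin d) => if x = ι t then (1 : ℝ) else 0) b x ≠ 0)
    (hb' : Matrix.fromRows (reM (QB N R M)) (fun (t : T) (x : Tor (fine (R * N) M) × Fin d) => if x = ι t then (1 : ℝ) else 0) b' x' ≠ 0) :
    (tdist (Sum.elim (fun b : Tor (fine N M) × Fin d => b.1) (fun t : T => par N R M (ι t).1) b)
           (Sum.elim (fun b : Tor (fine N M) × Fin d => b.1) (fun t : T => par N R M (ι t).1) b') : ℝ)
      ≤ (tdist (par N R M x.1) (par N R M x'.1) : ℝ) + 2 := by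
  have h1 := tdist_key_par_le_one N R M ι hb
  have h2 := tdist_key_par_le_one N R M ι hb'
  have h3 := tdist_triangle (Sum.elim (fun b : Tor (fine N M) × Fin d => b.1) (fun t : T => par N R M (ι t).1) b) (par N R M x.1)
    (Sum.elim (fun b : Tor (fine N M) × Fin d => b.1) (fun t : T => par N R M (ι t).1) b')
  have h4 := tdist_triangle (par N R M x.1) (par N R M x'.1) (Sum.elim (fun b : Tor (fine N M) × Fin d => b.1) (fun t : T => par N R M (ι t).1) b')
  rw [tdist_comm (Sum.elim (fun b : Tor (fine N M) × Fin d => b.1) (fun t : T => par N R M (ι t).1) b')] at h2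
  have h : tdist (Sum.elim (fun b : Tor (fine N M) × Fin d => b.1) (fun t : T => par N R M (ι t).1) b)
      (Sum.elim (fun b : Tor (fine N M) × Fin d => b.1) (fun t : T => par N R M (ι t).1) b') ≤ tdist (par N R M x.1) (par N R M x'.1) + 2 := by omega
  exact_mod_cast h

omit [Fintype T] [DecidableEq T] in
/-- **PART 105 §4's FINE-TO-UNIT COMPATIBILITY `hQσ` FOR THE STACKED CONSTRAINT** (`R′ = 1`): `Q_ax(b′,x′) ≠ 0 → tdist(par x, key b′) ≤ tdist(par x, par x′) + 1`. [folklore] -/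
theorem tdist_par_key_le_tdist_par_add_one {b' : (Tor (fine N M) × Fin d) ⊕ T} (x : Tor (fine (R * N) M) × Fin d) {x' : Tor (fine (R * N) M) × Fin d}
    (hb' : Matrix.fromRows (reM (QB N R M)) (fun (t : T) (x : Tor (fine (R * N) M) × Fin d) => if x = ι t then (1 : ℝ) else 0) b' x' ≠ 0) :
    (tdist (par N R M x.1) (Sum.elim (fun b : Tor (fine N M) × Fin d => b.1) (fun t : T => par N R M (ι t).1) b') : ℝ)
      ≤ (tdist (par N R M x.1) (par N R M x'.1) : ℝ) + 1 := by
  have h2 := tdist_key_par_le_one N R M ι hb'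
  have h4 := tdist_triangle (par N R M x.1) (par N R M x'.1) (Sum.elim (fun b : Tor (fine N M) × Fin d => b.1) (fun t : T => par N R M (ι t).1) b')
  rw [tdist_comm (Sum.elim (fun b : Tor (fine N M) × Fin d => b.1) (fun t : T => par N R M (ι t).1) b')] at h2
  have h : tdist (par N R M x.1) (Sum.elim (fun b : Tor (fine N M) × Fin d => b.1) (fun t : T => par N R M (ι t).1) b')
      ≤ tdist (par N R M x.1) (par N R M x'.1) + 1 := by omega
  exact_mod_cast h

end Gauges

/-! ## §2 The stacked regulariser `Q_axᵀ(a•1)Q_ax = (re QB)ᵀ(a•1)(re QB) + Eᵀ(a•1)E` and the soft letter -/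

section Soft

/-- **`fromRows_reg_eq` — THE STACKED REGULARISER SPLITS**: `(fromRows Q E)ᵀ(a•1)(fromRows Q E) = Qᵀ(a•1)Q + Eᵀ(a•1)E` (generic). [folklore] -/
theorem fromRows_reg_eq {c T' ν : Type*} [Fintype c] [Fintype T'] [DecidableEq c] [DecidableEq T'] (Q : Matrix c ν ℝ) (E : Matrix T' ν ℝ) (a : ℝ) :
    (Matrix.fromRows Q E)ᵀ * (a • (1 : Matrix (c ⊕ T') (c ⊕ T') ℝ)) * Matrix.fromRows Q E
      = Qᵀ * (a • (1 : Matrix c c ℝ)) * Q + Eᵀ * (a • (1 : Matrix T' T' ℝ)) * E := by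
  rw [transpose_mul_smul_one_mul, transpose_mul_smul_one_mul, transpose_mul_smul_one_mul, Matrix.transpose_fromRows,
    Matrix.fromCols_mul_fromRows, smul_add]

omit [NeZero N] [NeZero R] hM [DecidableEq T] in
/-- **`abs_projSum_le` — THE PROJECTION's REGULARISER IS DIAGONAL WITH ENTRIES `≤ a`**: `|a·Σ_t [x = ι t][x′ = ι t]| ≤ a·e^{−δ_H·tdist(par x, par x′)}` for every `a ≥ 0` and
every `δ_H` (off the diagonal the sum vanishes; on it the block distance is `0` and at most one bond of the family sits at `x`). [folklore] -/
theorem abs_projSum_le {a : ℝ} (ha : 0 ≤ a) (δH : ℝ) (x x' : Tor (fine (R * N) M) × Fin d) :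
    |a * ∑ t : T, (if x = ι t then (1 : ℝ) else 0) * (if x' = ι t then (1 : ℝ) else 0)|
      ≤ a * Real.exp (-(δH * (tdist (par N R M x.1) (par N R M x'.1) : ℝ))) := by
  by_cases hxx : x = x'
  · subst hxx
    rw [tdist_self, Nat.cast_zero, mul_zero, neg_zero, Real.exp_zero, mul_one]
    have hs : ∑ t : T, (if x = ι t then (1 : ℝ) else 0) * (if x = ι t then (1 : ℝ) else 0) = ∑ t : T, (if x = ι t then (1 : ℝ) else 0) :=
      Finset.sum_congr rfl fun t _ => by
        by_cases h1 : x = ι t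
        · rw [if_pos h1, mul_one]
        · rw [if_neg h1, mul_zero]
    rw [hs]
    by_cases hx : ∃ t, x = ι t
    · obtain ⟨t, rfl⟩ := hx
      have h1 := ext_apply_embed ι (fun _ => (1 : ℝ)) t
      rw [h1, mul_one, abs_of_nonneg ha]
    · have hx' : ∀ t, x ≠ ι t := fun t h => hx ⟨t, h⟩
      have h1 := ext_apply_of_not_range ι (fun _ => (1 : ℝ)) hx'
      rw [h1, mul_zero, abs_zero]
      exact ha
  · have h0 : ∑ t : T, (if x = ι t then (1 : ℝ) else 0) * (if x' = ι t then (1 : ℝ) else 0) = 0 :=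
      Finset.sum_eq_zero fun t _ => by
        by_cases h1 : x = ι t
        · rw [if_neg (fun h2 : x' = ι t => hxx (h1.trans h2.symm)), mul_zero]
        · rw [if_neg h1, zero_mul]
    rw [h0, mul_zero, abs_zero]
    positivity

/-- **`stackedReg_apply` — THE ENTRIES OF THE STACKED REGULARISER**: `(Q_axᵀ(a•1)Q_ax)(x,x′) = ((re QB)ᵀ(a•1)(re QB))(x,x′) + a·Σ_t [x = ι t][x′ = ι t]`. [folklore] -/
theorem stackedReg_apply (a : ℝ) (x x' : Tor (fine (R * N) M) × Fin d) :
    ((Matrix.fromRows (reM (QB N R M)) (fun (t : T) (x : Tor (fine (R * N) M) × Fin d) => if x = ι t then (1 : ℝ) else 0))ᵀ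
          * (a • (1 : Matrix ((Tor (fine N M) × Fin d) ⊕ T) ((Tor (fine N M) × Fin d) ⊕ T) ℝ))
          * Matrix.fromRows (reM (QB N R M)) (fun (t : T) (x : Tor (fine (R * N) M) × Fin d) => if x = ι t then (1 : ℝ) else 0)) x x'
      = ((reM (QB N R M))ᵀ * (a • (1 : Matrix (Tor (fine N M) × Fin d) (Tor (fine N M) × Fin d) ℝ)) * reM (QB N R M)) x x'
          + a * ∑ t : T, (if x = ι t then (1 : ℝ) else 0) * (if x' = ι t then (1 : ℝ) else 0) := by
  rw [fromRows_reg_eq, Matrix.add_apply]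
  congr 1
  rw [transpose_mul_smul_one_mul, Matrix.smul_apply, Matrix.mul_apply, smul_eq_mul]
  rfl

variable {H : Matrix (Tor (fine (R * N) M) × Fin d) (Tor (fine (R * N) M) × Fin d) ℝ} {Kf : ℝ → ℝ}

/-- **`abs_regFormAx_apply_le` — THE STACKED REGULARISED FORM IS LOCALISED**: `|K(x,x′)| ≤ ((h₀ + a·R^{−d}R^{−d}·e^{2δ_H}) + a)·e^{−δ_H·tdist(par x, par x′)}` for
`K = H + Q_axᵀ(a•1)Q_ax` (PART 170 `abs_regForm_apply_le` for the averaging part, `abs_projSum_le` for the projection part). [folklore] -/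
theorem abs_regFormAx_apply_le {a h₀ δH : ℝ} (ha : 0 ≤ a) (hδH : 0 ≤ δH)
    (hHent : ∀ x x', |H x x'| ≤ h₀ * Real.exp (-(δH * (tdist (par N R M x.1) (par N R M x'.1) : ℝ)))) (x x' : Tor (fine (R * N) M) × Fin d) :
    |(H + (Matrix.fromRows (reM (QB N R M)) (fun (t : T) (x : Tor (fine (R * N) M) × Fin d) => if x = ι t then (1 : ℝ) else 0))ᵀ
          * (a • (1 : Matrix ((Tor (fine N M) × Fin d) ⊕ T) ((Tor (fine N M) × Fin d) ⊕ T) ℝ))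
          * Matrix.fromRows (reM (QB N R M)) (fun (t : T) (x : Tor (fine (R * N) M) × Fin d) => if x = ι t then (1 : ℝ) else 0)) x x'| ≤
      ((h₀ + a * (((R : ℝ) ^ d)⁻¹ * ((R : ℝ) ^ d)⁻¹) * Real.exp (2 * δH)) + a) * Real.exp (-(δH * (tdist (par N R M x.1) (par N R M x'.1) : ℝ))) := by
  have e : (H + (Matrix.fromRows (reM (QB N R M)) (fun (t : T) (x : Tor (fine (R * N) M) × Fin d) => if x = ι t then (1 : ℝ) else 0))ᵀ
          * (a • (1 : Matrix ((Tor (fine N M) × Fin d) ⊕ T) ((Tor (fine N M) × Fin d) ⊕ T) ℝ))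
          * Matrix.fromRows (reM (QB N R M)) (fun (t : T) (x : Tor (fine (R * N) M) × Fin d) => if x = ι t then (1 : ℝ) else 0)) x x'
      = (H + (reM (QB N R M))ᵀ * (a • (1 : Matrix (Tor (fine N M) × Fin d) (Tor (fine N M) × Fin d) ℝ)) * reM (QB N R M)) x x'
          + a * ∑ t : T, (if x = ι t then (1 : ℝ) else 0) * (if x' = ι t then (1 : ℝ) else 0) := by
    rw [Matrix.add_apply, Matrix.add_apply, stackedReg_apply, add_assoc]
  rw [e, add_mul]
  exact (abs_add_le _ _).trans (add_le_add (abs_regForm_apply_le N R M ha hδH hHent x x') (abs_projSum_le N R M ι ha δH x x'))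

end Soft

end Summit.QuantumFields.BalabanUV.Beta.GAN24.OneStepConstraintAxialGauges

end
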